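import Summits.Ventures.Crystal3D.Theorems.StickyWulffConstantTextureLiminfTexShadowSteepPlateLaunch
import HarnessLib

/-!
# TexShadow row (e) / EDGE-ON (ε₂): the CORNER DICHOTOMY of the two-sided wide-steered ledger — steep pair, or both plates launch and a pair clause fails
# (lane T, crux `TextureLiminfV5`, stmt-Ventures-23912, sub-crux EDGE-ON; cf-p1 DECISION (cxxxvii)(2)(b) «EdgeOn ∧ ¬Steer2 ⊆ Steep₁ ∨ Steep₂ ∨ Sep ∨ Read»;
# memo HOME/wall-p1-g15/STEEP-PLATE-g15.md §3)

HONEST FRAMING. Venture `Summits/Ventures/Crystal3D` (cell `crystal3d-full`), route `route-Ventures-StickyWulffConstant`, helper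
`--supports` the law-v5 crux `TextureLiminfV5` (stmt-Ventures-23912).  PROOFS ONLY (logic on top of the dichotomy
`exists_steerLaunchAt_iff_not_steepPlateAt`); NO certificate is asserted; nothing about any wall law is proved; rung F-C1 not moved.

THE POINT.  `BarlowTwoSidedCertifiedSteerWide c₀ σ₁ σ₂ L₁ L₂ z₁ v₁ z₂ v₂` = LAUNCH₁(z₁,v₁) ∧ LAUNCH₂(z₂,v₂) ∧ PAIR-CLAUSES(z₁,v₁,z₂,v₂) where the pair clauses are
the two-sided flux sum (γ₂), the frame clauses (i), (ii) (no chain frame carries the other plate's two lattices — «READ») and (iii)_z (no co-axial chain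
frames — «SEP»).  With `SteerLaunchAt` (p706442) and the dichotomy «launch ⟺ ¬steep» (p707977):
* `twoSidedSteerWide_of_launches` — ASSEMBLY: two launches + the pair clauses ⇒ certified;
* **`steepPairAt_or_pairClauseFails_of_not_certified`** — THE CORNER DICHOTOMY: a faulted pair NOT certified by any `(z₁, v₁, z₂, v₂)` is either a STEEP PAIR
  (`SteepPairAt (1/3)`: the closed-form mechanism-only corner, solid angle §1 of the memo) or BOTH plates launch (explicitly) and for those launches a pair
  clause fails (flux sum / read / sep);
* `steepPairAt_or_pairClauseFails_of_not_menuCertified` — the same from `¬ BarlowMenuSteer2WideCertified` (the menu contains the two-sided families).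
* (appended) `steerSteepCos_antitone`, `steepPlateAt_mono` / `steepPairAt_mono` (the corner SHRINKS as the chord widens), `steerSteepCos_zero`,
  `steepPlateAt_zero_iff_not_deltaSteep` (chord `0`: the steep corner is exactly `¬ DeltaSteep`, the unsteered launch failure), `steepPlateAt_zero_of_steepPlateAt`.
WHAT THIS IS NOT: no coverage certificate; no sizing of the read/sep/flux parts (memo §3–§4: measured); F-C1 not moved.
-/

noncomputable section

open scoped BigOperators InnerProductSpace ENNReal
open MeasureTheory Filter

namespace Summit.Ventures.Crystal3D.Cruxes.TextureLiminf.TexShadow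

open Summit.Ventures.Crystal3D Summit.Ventures.Crystal3D.Theorems
open Literature.MathematicalPhysics.StatisticalMechanics (IsHaggSeq fccStacking barlowStacking basalMirror)

/-- **ASSEMBLY**: two launches at chord `1/3` (plate 1 toward `e₃`, plate 2 toward `−e₃`) together with the pair clauses (two-sided flux sum, frame
clauses (i), (ii), (iii)_z) give `BarlowTwoSidedCertifiedSteerWide`. -/
theorem twoSidedSteerWide_of_launches {c₀ : ℝ} {σ₁ σ₂ : ℤ → ℤ} {L₁ L₂ : E3 ≃ₗᵢ[ℝ] E3} {z₁ v₁ z₂ v₂ : E3}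
    (h₁ : SteerLaunchAt (1 / 3) L₁ σ₁ e₃ z₁ v₁) (h₂ : SteerLaunchAt (1 / 3) L₂ σ₂ (-e₃) z₂ v₂)
    (hflux : ∀ i j : ℤ, Real.sqrt 2 * c₀ ≤
      steerRise (upFrame L₁ e₃) (upWord L₁ σ₁ e₃) e₃ z₁ v₁ i + steerRise (upFrame L₂ (-e₃)) (upWord L₂ σ₂ (-e₃)) (-e₃) z₂ v₂ j)
    (hi : ∀ F ∈ chainFrames z₁ (upFrame L₁ e₃) v₁,
      F '' fccStacking 1 (Real.sqrt (2 / 3)) ≠ L₂ '' fccStacking 1 (Real.sqrt (2 / 3)) ∧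
      F '' fccStacking 1 (Real.sqrt (2 / 3)) ≠ (twinFrame L₂ (L₂ e₃)) '' fccStacking 1 (Real.sqrt (2 / 3)))
    (hii : ∀ F ∈ chainFrames z₂ (upFrame L₂ (-e₃)) v₂,
      F '' fccStacking 1 (Real.sqrt (2 / 3)) ≠ L₁ '' fccStacking 1 (Real.sqrt (2 / 3)) ∧
      F '' fccStacking 1 (Real.sqrt (2 / 3)) ≠ (twinFrame L₁ (L₁ e₃)) '' fccStacking 1 (Real.sqrt (2 / 3)))
    (hiii : ∀ F₁ ∈ chainFrames z₁ (upFrame L₁ e₃) v₁, ∀ F₂ ∈ chainFrames z₂ (upFrame L₂ (-e₃)) v₂, ¬ CoAxFrames F₁ F₂) :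
    BarlowTwoSidedCertifiedSteerWide c₀ σ₁ σ₂ L₁ L₂ z₁ v₁ z₂ v₂ := by
  obtain ⟨hz₁, hc₁, hv₁, hv₁2, hs₁, hcap₁⟩ := h₁
  obtain ⟨hz₂, hc₂, hv₂, hv₂2, hs₂, hcap₂⟩ := h₂
  exact ⟨hz₁, hc₁, hv₁, hv₁2, hs₁, hcap₁, hz₂, hc₂, hv₂, hv₂2, hs₂, hcap₂, hflux, hi, hii, hiii⟩

/-- **THE CORNER DICHOTOMY.**  If NO steering `(z₁, v₁, z₂, v₂)` certifies the pair two-sidedly, then EITHER the pair is steep (`SteepPairAt (1/3)`: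
some plate has all three reference up-slots rising by `< (17√2 − √70)/36` toward the wall — the closed-form mechanism-only corner) OR both plates DO
launch (the explicit steerings of `exists_steerLaunchAt_of_not_steepPlateAt`) and for these launches one of the pair clauses fails: the two-sided flux
sum, a frame clause (i)/(ii) («read»), or (iii)_z («sep»). -/
theorem steepPairAt_or_pairClauseFails_of_not_certified {c₀ : ℝ} {σ₁ σ₂ : ℤ → ℤ} {L₁ L₂ : E3 ≃ₗᵢ[ℝ] E3}
    (h : ¬ ∃ z₁ v₁ z₂ v₂ : E3, BarlowTwoSidedCertifiedSteerWide c₀ σ₁ σ₂ L₁ L₂ z₁ v₁ z₂ v₂) :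
    SteepPairAt (1 / 3) σ₁ σ₂ L₁ L₂ ∨
      ∃ z₁ v₁ z₂ v₂ : E3, SteerLaunchAt (1 / 3) L₁ σ₁ e₃ z₁ v₁ ∧ SteerLaunchAt (1 / 3) L₂ σ₂ (-e₃) z₂ v₂ ∧
        ¬ ((∀ i j : ℤ, Real.sqrt 2 * c₀ ≤
              steerRise (upFrame L₁ e₃) (upWord L₁ σ₁ e₃) e₃ z₁ v₁ i + steerRise (upFrame L₂ (-e₃)) (upWord L₂ σ₂ (-e₃)) (-e₃) z₂ v₂ j) ∧
          (∀ F ∈ chainFrames z₁ (upFrame L₁ e₃) v₁,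
              F '' fccStacking 1 (Real.sqrt (2 / 3)) ≠ L₂ '' fccStacking 1 (Real.sqrt (2 / 3)) ∧
              F '' fccStacking 1 (Real.sqrt (2 / 3)) ≠ (twinFrame L₂ (L₂ e₃)) '' fccStacking 1 (Real.sqrt (2 / 3))) ∧
          (∀ F ∈ chainFrames z₂ (upFrame L₂ (-e₃)) v₂,
              F '' fccStacking 1 (Real.sqrt (2 / 3)) ≠ L₁ '' fccStacking 1 (Real.sqrt (2 / 3)) ∧
              F '' fccStacking 1 (Real.sqrt (2 / 3)) ≠ (twinFrame L₁ (L₁ e₃)) '' fccStacking 1 (Real.sqrt (2 / 3))) ∧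
          (∀ F₁ ∈ chainFrames z₁ (upFrame L₁ e₃) v₁, ∀ F₂ ∈ chainFrames z₂ (upFrame L₂ (-e₃)) v₂, ¬ CoAxFrames F₁ F₂)) := by
  by_cases hs : SteepPairAt (1 / 3) σ₁ σ₂ L₁ L₂
  · exact Or.inl hs
  · right
    have hs₁ : ¬ SteepPlateAt (1 / 3) L₁ e₃ := fun h' => hs (Or.inl h')
    have hs₂ : ¬ SteepPlateAt (1 / 3) L₂ (-e₃) := fun h' => hs (Or.inr h')
    obtain ⟨z₁, v₁, hl₁⟩ := (exists_steerLaunchAt_iff_not_steepPlateAt_third L₁ σ₁).2 hs₁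
    obtain ⟨z₂, v₂, hl₂⟩ := (exists_steerLaunchAt_iff_not_steepPlateAt_third_neg L₂ σ₂).2 hs₂
    refine ⟨z₁, v₁, z₂, v₂, hl₁, hl₂, fun hcl => h ⟨z₁, v₁, z₂, v₂, ?_⟩⟩
    exact twoSidedSteerWide_of_launches hl₁ hl₂ hcl.1 hcl.2.1 hcl.2.2.1 hcl.2.2.2

/-- The corner dichotomy from the MENU form: a pair not `BarlowMenuSteer2WideCertified` is steep or launches with a failing pair clause (and, a fortiori,
is not certified one-sidedly either). -/
theorem steepPairAt_or_pairClauseFails_of_not_menuCertified {c₀ : ℝ} {σ₁ σ₂ : ℤ → ℤ} {L₁ L₂ : E3 ≃ₗᵢ[ℝ] E3}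
    (h : ¬ BarlowMenuSteer2WideCertified c₀ σ₁ σ₂ L₁ L₂) :
    SteepPairAt (1 / 3) σ₁ σ₂ L₁ L₂ ∨
      ∃ z₁ v₁ z₂ v₂ : E3, SteerLaunchAt (1 / 3) L₁ σ₁ e₃ z₁ v₁ ∧ SteerLaunchAt (1 / 3) L₂ σ₂ (-e₃) z₂ v₂ ∧
        ¬ ((∀ i j : ℤ, Real.sqrt 2 * c₀ ≤
              steerRise (upFrame L₁ e₃) (upWord L₁ σ₁ e₃) e₃ z₁ v₁ i + steerRise (upFrame L₂ (-e₃)) (upWord L₂ σ₂ (-e₃)) (-e₃) z₂ v₂ j) ∧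
          (∀ F ∈ chainFrames z₁ (upFrame L₁ e₃) v₁,
              F '' fccStacking 1 (Real.sqrt (2 / 3)) ≠ L₂ '' fccStacking 1 (Real.sqrt (2 / 3)) ∧
              F '' fccStacking 1 (Real.sqrt (2 / 3)) ≠ (twinFrame L₂ (L₂ e₃)) '' fccStacking 1 (Real.sqrt (2 / 3))) ∧
          (∀ F ∈ chainFrames z₂ (upFrame L₂ (-e₃)) v₂,
              F '' fccStacking 1 (Real.sqrt (2 / 3)) ≠ L₁ '' fccStacking 1 (Real.sqrt (2 / 3)) ∧
              F '' fccStacking 1 (Real.sqrt (2 / 3)) ≠ (twinFrame L₁ (L₁ e₃)) '' fccStacking 1 (Real.sqrt (2 / 3))) ∧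
          (∀ F₁ ∈ chainFrames z₁ (upFrame L₁ e₃) v₁, ∀ F₂ ∈ chainFrames z₂ (upFrame L₂ (-e₃)) v₂, ¬ CoAxFrames F₁ F₂)) :=
  steepPairAt_or_pairClauseFails_of_not_certified fun ⟨z₁, v₁, z₂, v₂, hc⟩ => h (Or.inr ⟨z₁, v₁, z₂, v₂, hc⟩)


/-! ## The corner shrinks with the chord; chord `0` is Δ-steepness (appended 2026-08-29, 19480-p1 g15) -/

/-- `steerSteepCos` is antitone in the chord on `[0, 1]`: a wider steering chord lowers the rise threshold. -/
theorem steerSteepCos_antitone {c c' : ℝ} (hc0 : 0 ≤ c) (hcc' : c ≤ c') (hc'1 : c' ≤ 1) :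
    steerSteepCos c' ≤ steerSteepCos c := by
  unfold steerSteepCos
  have hc'0 : 0 ≤ c' := hc0.trans hcc'
  have hs2 : 0 ≤ Real.sqrt 2 / 2 := by positivity
  have hg0 : 0 ≤ c * Real.sqrt (1 - c ^ 2 / 4) := mul_nonneg hc0 (Real.sqrt_nonneg _)
  have hg0' : 0 ≤ c' * Real.sqrt (1 - c' ^ 2 / 4) := mul_nonneg hc'0 (Real.sqrt_nonneg _)
  -- `c ↦ c·√(1 − c²/4) = sin θ_c` is increasing on `[0, 1]`: compare squares
  have hsq : (c * Real.sqrt (1 - c ^ 2 / 4)) ^ 2 ≤ (c' * Real.sqrt (1 - c' ^ 2 / 4)) ^ 2 := by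
    rw [mul_pow, mul_pow, Real.sq_sqrt (by nlinarith), Real.sq_sqrt (by nlinarith)]
    have hcc2 : c ^ 2 ≤ c' ^ 2 := pow_le_pow_left₀ hc0 hcc' 2
    have hc'2 : c' ^ 2 ≤ 1 := by nlinarith
    have hA : 0 ≤ c' ^ 2 - c ^ 2 := sub_nonneg.2 hcc2
    have hB : 0 ≤ 1 - (c' ^ 2 + c ^ 2) / 4 := by linarith
    have key : c' ^ 2 * (1 - c' ^ 2 / 4) - c ^ 2 * (1 - c ^ 2 / 4) = (c' ^ 2 - c ^ 2) * (1 - (c' ^ 2 + c ^ 2) / 4) := by ring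
    nlinarith [mul_nonneg hA hB, key]
  have hg : c * Real.sqrt (1 - c ^ 2 / 4) ≤ c' * Real.sqrt (1 - c' ^ 2 / 4) := (pow_le_pow_iff_left₀ hg0 hg0' two_ne_zero).1 hsq
  have hcc2 : c ^ 2 ≤ c' ^ 2 := pow_le_pow_left₀ hc0 hcc' 2
  apply mul_le_mul_of_nonneg_left _ hs2
  linarith

/-- **The steep corner shrinks as the chord widens**: `SteepPlateAt c' L e → SteepPlateAt c L e` for `0 ≤ c ≤ c' ≤ 1`. -/
theorem steepPlateAt_mono {c c' : ℝ} {L : E3 ≃ₗᵢ[ℝ] E3} {e : E3} (hc0 : 0 ≤ c) (hcc' : c ≤ c') (hc'1 : c' ≤ 1)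
    (h : SteepPlateAt c' L e) : SteepPlateAt c L e :=
  fun v hv hv2 => (h v hv hv2).trans_le (steerSteepCos_antitone hc0 hcc' hc'1)

/-- Likewise for pairs. -/
theorem steepPairAt_mono {c c' : ℝ} {σ₁ σ₂ : ℤ → ℤ} {L₁ L₂ : E3 ≃ₗᵢ[ℝ] E3} (hc0 : 0 ≤ c) (hcc' : c ≤ c') (hc'1 : c' ≤ 1)
    (h : SteepPairAt c' σ₁ σ₂ L₁ L₂) : SteepPairAt c σ₁ σ₂ L₁ L₂ :=
  h.imp (steepPlateAt_mono hc0 hcc' hc'1) (steepPlateAt_mono hc0 hcc' hc'1)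

/-- Chord `0`: `steerSteepCos 0 = √2/2`. -/
theorem steerSteepCos_zero : steerSteepCos 0 = Real.sqrt 2 / 2 := by
  unfold steerSteepCos; norm_num

/-- **At chord `0` the steep corner is exactly the complement of Δ-steepness** (`DeltaSteep`, the launch condition of the `±e₃`-steered ledgers):
the steered corner `SteepPlateAt c` (`c > 0`) is a sub-corner of the unsteered one. -/
theorem steepPlateAt_zero_iff_not_deltaSteep (L : E3 ≃ₗᵢ[ℝ] E3) (e : E3) : SteepPlateAt 0 L e ↔ ¬ DeltaSteep L e := by
  unfold SteepPlateAt DeltaSteep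
  rw [steerSteepCos_zero]
  constructor
  · rintro h ⟨v, hv, hv2, hle⟩
    exact absurd (h v hv hv2) (not_lt.2 hle)
  · intro h v hv hv2
    by_contra hcon
    exact h ⟨v, hv, hv2, le_of_not_gt hcon⟩

/-- Hence every steered steep plate (`0 ≤ c ≤ 1`) is a non-Δ-steep plate: `SteepPlateAt c ⊆ SteepPlateAt 0 = ¬DeltaSteep`. -/
theorem steepPlateAt_zero_of_steepPlateAt {c : ℝ} {L : E3 ≃ₗᵢ[ℝ] E3} {e : E3} (hc0 : 0 ≤ c) (hc1 : c ≤ 1) (h : SteepPlateAt c L e) :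
    SteepPlateAt 0 L e :=
  steepPlateAt_mono le_rfl hc0 hc1 h
end Summit.Ventures.Crystal3D.Cruxes.TextureLiminf.TexShadow

end
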